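import Summits.SmoothPoincare4.SmoothPoincare4.Theorems.ConvexBisectionAcyclicBisectionExistsComplementPieceSeamLevel
import Summits.SmoothPoincare4.SmoothPoincare4.Theorems.ConvexBisectionAcyclicBisectionExistsComplementPieceHandleChart
import Summits.SmoothPoincare4.SmoothPoincare4.Theorems.ConvexBisectionAcyclicBisectionExistsDualHandleModelRegionDefs
import Literature.Topology.FourManifolds.CollarExtension
import HarnessLib

/-!
# The complement piece `W₂`, III: the bump `Ωⱼ` around a cocore and its push-forward to `M'`
(helper file 3 of the wave-4 brick T3b (iii) "the complement piece `W₂ = {Φ ≤ 0}` of the pushed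
prefix sub-handlebody inside Milnor's gluing" for stub `stub_steinRealisation` (NF6), line
`modp-braid-orbits` r11, crux `ConvexBisection.AcyclicBisectionExists`, item stmt-SmoothPoincare4-10508;
lead c5, worker Y6)

The level function of the complement piece is `Φ = Φ₀ + Σⱼ Ψⱼ` with `Φ₀` the signed seam level of
Milnor's gluing `M' = G.d₂.Glued` (file I) and `Ψⱼ` the push-forward by zero, along the glued handle
chart `Θⱼ = gluedHandleChart D j G a : ℝ⁴ ⊇ chartDom a → M'` of the `j`-th handle (file II), of the
compactly supported smooth function `gⱼ = Ω · (H - Φ₀ ∘ Θⱼ)` on `ℝ⁴`; here `H = modelH κ δ` is Z2's model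
function of the pushed sub-handlebody (`…DualHandleModelRegionDefs.lean`) and
`Ω x = lamCutoff κ ‖x_λ‖² · radCutoff d (‖x‖² - 1)` (`d = min (1/5) a`) is a smooth bump, `= 1` on
`{‖x_λ‖² ≤ 13κ²/16, ‖x‖² ≤ 1 + d/3} ⊇` (cocore neighbourhood `N` ∪ nearby seam), supported in the
compact `bumpSupp κ a = {‖x_λ‖² ≤ 15κ²/16, ‖x‖² ≤ 1 + 2d/3} ⊆ chartDom a` (V5-REPORT §3.2:
"`Ωⱼ = ω₂(P) ϖ(r² - 1)` supported in `Ξ(𝓞) ∪ jM jB_j {P < 1/4}`").  So `Φ ∘ Θⱼ = (1 - Ω) Φ₀ ∘ Θⱼ + Ω H`.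

* `lamCutoff`, `radCutoff`, `bumpLoc`, `bumpSupp` and their plateaus / support / compactness;
* `bumpFn D i G a κ δ = Ω · (H - Φ₀ ∘ Θᵢ)`, smooth on `chartDom a`, vanishing off `bumpSupp`;
* `bumpPush D i G a κ δ : M' → ℝ` — the push-forward by zero; **smooth** (`contMDiff_bumpPush`: at chart
  points by descent along the local smooth embeddings of file II, `contMDiffAt_of_comp_isImmersionAt_of_nhds`;
  zero near the complement of the closed `Θᵢ (bumpSupp)`), `= bumpFn` on chart points, `= 0` on the
  charts of the other handles.

Everything here is proved; no named facts.

## References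
* J. Milnor, *Morse theory* (1963), §2–§3. [Milnor1963]
* A. A. Kosinski, *Differential Manifolds* (1993), VI §1 (proof of (1.1)), VI §6. [Kosinski1993]
-/

noncomputable section

-- the prescribed namespace `Summit.<P>.<Sub>.…` duplicates `SmoothPoincare4` (P = Sub)
set_option linter.dupNamespace false

open scoped Manifold ContDiff Topology

namespace Summit.SmoothPoincare4.SmoothPoincare4.Theorems.AcyclicBisectionExists.ModpBraidOrbits

open Set Function Metric Filter Topology
open Literature.Topology.FourManifolds Literature.Topology.FourManifolds.HandleAttachingMap

/-! ### §1 The cut-offs and the bump -/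

section Cutoffs

/-- **The `P`-cut-off** `S((15κ²/16 - P)·8/κ²)`: `1` for `P ≤ 13κ²/16`, `0` for `P ≥ 15κ²/16`. [folklore] -/
def lamCutoff (κ P : ℝ) : ℝ := Real.smoothTransition ((15 * κ ^ 2 / 16 - P) * (8 / κ ^ 2))

/-- **The radial cut-off** `S((2d/3 - u)·3/d)`: `1` for `u ≤ d/3`, `0` for `u ≥ 2d/3`. [folklore] -/
def radCutoff (d u : ℝ) : ℝ := Real.smoothTransition ((2 * d / 3 - u) * (3 / d))

/-- `lamCutoff` is smooth in `P`. [folklore] -/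
theorem contDiff_lamCutoff (κ : ℝ) : ContDiff ℝ ∞ (lamCutoff κ) :=
  Real.smoothTransition.contDiff.comp ((contDiff_const.sub contDiff_id).mul contDiff_const)

/-- `radCutoff` is smooth in `u`. [folklore] -/
theorem contDiff_radCutoff (d : ℝ) : ContDiff ℝ ∞ (radCutoff d) :=
  Real.smoothTransition.contDiff.comp ((contDiff_const.sub contDiff_id).mul contDiff_const)

/-- `lamCutoff ∈ [0, 1]`. [folklore] -/
theorem lamCutoff_mem (κ P : ℝ) : lamCutoff κ P ∈ Icc (0 : ℝ) 1 :=
  ⟨Real.smoothTransition.nonneg _, Real.smoothTransition.le_one _⟩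

/-- `radCutoff ∈ [0, 1]`. [folklore] -/
theorem radCutoff_mem (d u : ℝ) : radCutoff d u ∈ Icc (0 : ℝ) 1 :=
  ⟨Real.smoothTransition.nonneg _, Real.smoothTransition.le_one _⟩

/-- `lamCutoff = 1` for `P ≤ 13κ²/16`. [folklore] -/
theorem lamCutoff_eq_one {κ P : ℝ} (hκ : 0 < κ) (hP : P ≤ 13 * κ ^ 2 / 16) : lamCutoff κ P = 1 := by
  unfold lamCutoff
  apply Real.smoothTransition.one_of_one_le
  have hκ2 : 0 < κ ^ 2 := by positivity
  rw [← div_le_iff₀ (by positivity : (0 : ℝ) < 8 / κ ^ 2)]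
  rw [div_div_eq_mul_div, one_mul, div_le_iff₀ (by norm_num : (0 : ℝ) < 8)]
  nlinarith

/-- `lamCutoff = 0` for `P ≥ 15κ²/16`. [folklore] -/
theorem lamCutoff_eq_zero {κ P : ℝ} (hκ : 0 < κ) (hP : 15 * κ ^ 2 / 16 ≤ P) : lamCutoff κ P = 0 := by
  unfold lamCutoff
  apply Real.smoothTransition.zero_of_nonpos
  have : 0 < 8 / κ ^ 2 := by positivity
  nlinarith

/-- `radCutoff = 1` for `u ≤ d/3`. [folklore] -/
theorem radCutoff_eq_one {d u : ℝ} (hd : 0 < d) (hu : u ≤ d / 3) : radCutoff d u = 1 := by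
  unfold radCutoff
  apply Real.smoothTransition.one_of_one_le
  rw [← div_le_iff₀ (by positivity : (0 : ℝ) < 3 / d)]
  rw [div_div_eq_mul_div, one_mul, div_le_iff₀ (by norm_num : (0 : ℝ) < 3)]
  nlinarith

/-- `radCutoff = 0` for `u ≥ 2d/3`. [folklore] -/
theorem radCutoff_eq_zero {d u : ℝ} (hd : 0 < d) (hu : 2 * d / 3 ≤ u) : radCutoff d u = 0 := by
  unfold radCutoff
  apply Real.smoothTransition.zero_of_nonpos
  have : 0 < 3 / d := by positivity
  nlinarith

/-- **The bump `Ω x = lamCutoff κ ‖x_λ‖² · radCutoff (min (1/5) a) (‖x‖² - 1)`** in the handle coordinates.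
[cite: Milnor1963, §3] -/
def bumpLoc (κ a : ℝ) (x : EuclideanSpace ℝ (Fin 4)) : ℝ :=
  lamCutoff κ (‖lamPart x‖ ^ 2) * radCutoff (min (1 / 5) a) (‖x‖ ^ 2 - 1)

/-- The bump is smooth. [folklore] -/
theorem contDiff_bumpLoc (κ a : ℝ) : ContDiff ℝ ∞ (bumpLoc κ a) :=
  ((contDiff_lamCutoff κ).comp contDiff_lamNormSq).mul
    ((contDiff_radCutoff _).comp ((contDiff_norm_sq ℝ).sub contDiff_const))

/-- `Ω ∈ [0, 1]`. [folklore] -/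
theorem bumpLoc_mem (κ a : ℝ) (x : EuclideanSpace ℝ (Fin 4)) : bumpLoc κ a x ∈ Icc (0 : ℝ) 1 := by
  have h1 := lamCutoff_mem κ (‖lamPart x‖ ^ 2)
  have h2 := radCutoff_mem (min (1 / 5) a) (‖x‖ ^ 2 - 1)
  exact ⟨mul_nonneg h1.1 h2.1, mul_le_one₀ h1.2 h2.1 h2.2⟩

/-- **The support box** `{‖x_λ‖² ≤ 15κ²/16, ‖x‖² ≤ 1 + 2d/3}` of the bump. [folklore] -/
def bumpSupp (κ a : ℝ) : Set (EuclideanSpace ℝ (Fin 4)) :=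
  {x | ‖lamPart x‖ ^ 2 ≤ 15 * κ ^ 2 / 16 ∧ ‖x‖ ^ 2 ≤ 1 + 2 * min (1 / 5) a / 3}

/-- Off the support box the bump vanishes. [folklore] -/
theorem bumpLoc_eq_zero_of_not_mem {κ a : ℝ} (hκ : 0 < κ) (ha : 0 < a) {x : EuclideanSpace ℝ (Fin 4)}
    (hx : x ∉ bumpSupp κ a) : bumpLoc κ a x = 0 := by
  have hd : 0 < min (1 / 5 : ℝ) a := lt_min (by norm_num) ha
  simp only [bumpSupp, mem_setOf_eq, not_and_or, not_le] at hx
  unfold bumpLoc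
  rcases hx with hx | hx
  · rw [lamCutoff_eq_zero hκ hx.le, zero_mul]
  · rw [radCutoff_eq_zero hd (by linarith), mul_zero]

/-- **The plateau**: `Ω = 1` for `‖x_λ‖² ≤ 13κ²/16`, `‖x‖² ≤ 1 + d/3`. [folklore] -/
theorem bumpLoc_eq_one {κ a : ℝ} (hκ : 0 < κ) (ha : 0 < a) {x : EuclideanSpace ℝ (Fin 4)}
    (hP : ‖lamPart x‖ ^ 2 ≤ 13 * κ ^ 2 / 16) (hr : ‖x‖ ^ 2 ≤ 1 + min (1 / 5) a / 3) : bumpLoc κ a x = 1 := by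
  have hd : 0 < min (1 / 5 : ℝ) a := lt_min (by norm_num) ha
  unfold bumpLoc
  rw [lamCutoff_eq_one hκ hP, radCutoff_eq_one hd (by linarith), one_mul]

/-- In the closed ball the radial cut-off is `1`: `Ω x = lamCutoff κ ‖x_λ‖²`. [folklore] -/
theorem bumpLoc_of_norm_le_one {κ a : ℝ} (ha : 0 < a) {x : EuclideanSpace ℝ (Fin 4)} (hx : ‖x‖ ≤ 1) :
    bumpLoc κ a x = lamCutoff κ (‖lamPart x‖ ^ 2) := by
  have hd : 0 < min (1 / 5 : ℝ) a := lt_min (by norm_num) ha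
  unfold bumpLoc
  rw [radCutoff_eq_one hd (by nlinarith [norm_nonneg x]), mul_one]

/-- The support box is compact. [folklore] -/
theorem isCompact_bumpSupp (κ a : ℝ) : IsCompact (bumpSupp κ a) := by
  have hcl : IsClosed (bumpSupp κ a) :=
    (isClosed_le (contDiff_lamNormSq.continuous) continuous_const).inter
      (isClosed_le (continuous_norm.pow 2) continuous_const)
  refine (isCompact_closedBall (0 : EuclideanSpace ℝ (Fin 4)) 2).of_isClosed_subset hcl fun x hx => ?_
  rw [mem_closedBall_zero_iff]
  have h1 : min (1 / 5 : ℝ) a ≤ 1 / 5 := min_le_left _ _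
  nlinarith [hx.2, norm_nonneg x]

/-- Points of the support box have `‖x_λ‖ < ½` and `x_μ ≠ 0` (`κ ≤ ½`). [folklore] -/
theorem lamPart_lt_of_mem_bumpSupp {κ a : ℝ} (hκ2 : κ ≤ 1 / 2) (hκ : 0 < κ) {x : EuclideanSpace ℝ (Fin 4)}
    (hx : x ∈ bumpSupp κ a) : ‖lamPart x‖ < 1 / 2 ∧ ‖lamPart x‖ ^ 2 < 1 / 4 := by
  have h1 : ‖lamPart x‖ ^ 2 < 1 / 4 := by nlinarith [hx.1, mul_pos hκ hκ]
  refine ⟨?_, h1⟩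
  nlinarith [norm_nonneg (lamPart x)]

/-- **The support box lies in the chart domain** (`0 < κ ≤ ½`, `0 < a`). [folklore] -/
theorem bumpSupp_subset_chartDom {κ a : ℝ} (hκ : 0 < κ) (hκ2 : κ ≤ 1 / 2) (ha : 0 < a) :
    bumpSupp κ a ⊆ chartDom a := by
  intro x hx
  by_cases h1 : ‖x‖ < 1
  · exact Or.inl (mem_ball_zero_iff.2 h1)
  · right
    have hd : 0 < min (1 / 5 : ℝ) a := lt_min (by norm_num) ha
    have hP := (lamPart_lt_of_mem_bumpSupp hκ2 hκ hx)
    have hn : 1 ≤ ‖x‖ := not_lt.1 h1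
    have hn2 : 1 ≤ ‖x‖ ^ 2 := by nlinarith
    refine ⟨?_, hP.1, ?_⟩
    · intro h0
      have h2 := norm_sq_eq_lamPart_muPart x
      rw [h0, norm_zero] at h2
      nlinarith [hP.2]
    · rw [abs_lt]
      constructor <;> nlinarith [hx.2]

end Cutoffs

/-! ### §2 The bump function `gᵢ = Ω · (H - Φ₀ ∘ Θᵢ)` and its push-forward -/

section Push

variable {B : Type} [TopologicalSpace B] [T2Space B] [ChartedSpace (EuclideanHalfSpace 4) B]
  {ι : Type} [Finite ι] {h : ι → HandleAttachingMap 3 2 B}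
  {X : Type} [TopologicalSpace X] [ChartedSpace (EuclideanHalfSpace 4) X] [IsManifold (𝓡∂ 4) ∞ X]
  (D : MultiAttachmentData h (𝓡∂ 4) X) (i : ι) {bX : BoundaryData (𝓡∂ 4) X (𝓡 3)}
  {W : Type} [TopologicalSpace W] [ChartedSpace (EuclideanHalfSpace 4) W]
  [IsManifold (𝓡∂ 4) ∞ W] {bW : BoundaryData (𝓡∂ 4) W (𝓡 3)} [Nonempty bX.carrier]
  (G : BoundaryGlueData bX bW) (a κ δ : ℝ)

/-- **The bump function `gᵢ x = Ω x · (H x - Φ₀ (Θᵢ x))`** in the coordinates of the `i`-th handle.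
[cite: Milnor1963, §3] -/
def bumpFn (x : EuclideanSpace ℝ (Fin 4)) : ℝ :=
  bumpLoc κ a x * (modelH κ δ x - seamLevelFn G (gluedHandleChart D i G a x))

/-- The chart domain as an open submanifold of `ℝ⁴`. [folklore] -/
def chartOpens (a : ℝ) : TopologicalSpace.Opens (EuclideanSpace ℝ (Fin 4)) := ⟨chartDom a, isOpen_chartDom a⟩

/-- **The push-forward by zero `Ψᵢ : M' → ℝ`** of `gᵢ` along the glued handle chart on `chartDom a`.
[cite: Kosinski1993, VI §1] -/
def bumpPush : G.d₂.Glued → ℝ :=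
  Function.extend (fun y : ↥(chartOpens a) => gluedHandleChart D i G a y.1) (fun y => bumpFn D i G a κ δ y.1) 0

variable {a κ δ}

/-- Off the support box the bump function vanishes. [folklore] -/
theorem bumpFn_eq_zero_of_not_mem (hκ : 0 < κ) (ha : 0 < a) {x : EuclideanSpace ℝ (Fin 4)}
    (hx : x ∉ bumpSupp κ a) : bumpFn D i G a κ δ x = 0 := by
  rw [bumpFn, bumpLoc_eq_zero_of_not_mem hκ ha hx, zero_mul]

/-- The chart restricted to the chart domain is injective. [folklore] -/
theorem injective_chart_restrict (ha : 0 < a) (hCM : CollarAdapted D i G a) :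
    Injective fun y : ↥(chartOpens a) => gluedHandleChart D i G a y.1 := fun y y' hyy' =>
  Subtype.ext (injOn_gluedHandleChart D i G ha hCM y.2 y'.2 hyy')

/-- **`Ψᵢ (Θᵢ x) = gᵢ x` on the chart domain.** [folklore] -/
theorem bumpPush_apply_chart (ha : 0 < a) (hCM : CollarAdapted D i G a) {x : EuclideanSpace ℝ (Fin 4)}
    (hx : x ∈ chartDom a) : bumpPush D i G a κ δ (gluedHandleChart D i G a x) = bumpFn D i G a κ δ x :=
  extend_zero_apply (injective_chart_restrict D i G ha hCM) (fun y => bumpFn D i G a κ δ y.1) ⟨x, hx⟩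

/-- **`Ψᵢ = 0` off `Θᵢ (bumpSupp)`.** [folklore] -/
theorem bumpPush_eq_zero_of_not_mem (ha : 0 < a) (hCM : CollarAdapted D i G a) (hκ : 0 < κ)
    {p : G.d₂.Glued} (hp : p ∉ gluedHandleChart D i G a '' bumpSupp κ a) : bumpPush D i G a κ δ p = 0 := by
  refine extend_zero_eq_zero_of_not_mem (injective_chart_restrict D i G ha hCM) _
    (K := gluedHandleChart D i G a '' bumpSupp κ a) (fun y hy => ?_) hp
  exact bumpFn_eq_zero_of_not_mem D i G hκ ha fun h' => hy ⟨y.1, h', rfl⟩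

/-- **`Ψᵢ' = 0` on the chart of another handle `i ≠ i'`.** [folklore] -/
theorem bumpPush_chart_ne (ha : 0 < a) {i i' : ι} (hii' : i ≠ i') (hCM : CollarAdapted D i G a)
    (hCM' : CollarAdapted D i' G a) (hκ : 0 < κ) (hκ2 : κ ≤ 1 / 2) {x : EuclideanSpace ℝ (Fin 4)}
    (hx : x ∈ chartDom a) : bumpPush D i' G a κ δ (gluedHandleChart D i G a x) = 0 := by
  refine bumpPush_eq_zero_of_not_mem D i' G ha hCM' hκ ?_
  rintro ⟨x', hx', heq⟩
  exact gluedHandleChart_ne D G ha hii' hCM hCM' hx (bumpSupp_subset_chartDom hκ hκ2 ha hx') heq.symm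

variable [CompactSpace X] [T2Space X] [T2Space W] [CompactSpace W]

/-- `Φ₀ ∘ Θᵢ` is smooth on the chart domain. [folklore] -/
theorem contMDiffOn_seamLevelFn_chart (ha : 0 < a) (hCM : CollarAdapted D i G a) :
    ContMDiffOn 𝓘(ℝ, EuclideanSpace ℝ (Fin 4)) 𝓘(ℝ, ℝ) ∞
      (fun x => seamLevelFn G (gluedHandleChart D i G a x)) (chartDom a) :=
  (contMDiff_seamLevelFn G).comp_contMDiffOn (contMDiffOn_gluedHandleChart D i G ha hCM)

/-- **The bump function is smooth on the chart domain.** [folklore] -/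
theorem contMDiffOn_bumpFn (ha : 0 < a) (hCM : CollarAdapted D i G a) :
    ContMDiffOn 𝓘(ℝ, EuclideanSpace ℝ (Fin 4)) 𝓘(ℝ, ℝ) ∞ (bumpFn D i G a κ δ) (chartDom a) :=
  (contDiff_bumpLoc κ a).contMDiff.contMDiffOn.mul
    ((contDiff_modelH κ δ).contMDiff.contMDiffOn.sub (contMDiffOn_seamLevelFn_chart D i G ha hCM))

omit [CompactSpace W] in
/-- The image of the support box under the chart is compact. [folklore] -/
theorem isCompact_image_bumpSupp (ha : 0 < a) (hCM : CollarAdapted D i G a) (hκ : 0 < κ) (hκ2 : κ ≤ 1 / 2) :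
    IsCompact (gluedHandleChart D i G a '' bumpSupp κ a) :=
  (isCompact_bumpSupp κ a).image_of_continuousOn
    ((contMDiffOn_gluedHandleChart D i G ha hCM).continuousOn.mono (bumpSupp_subset_chartDom hκ hκ2 ha))

omit [CompactSpace W] in
/-- The image of the support box under the chart is closed. [folklore] -/
theorem isClosed_image_bumpSupp (ha : 0 < a) (hCM : CollarAdapted D i G a) (hκ : 0 < κ) (hκ2 : κ ≤ 1 / 2) :
    IsClosed (gluedHandleChart D i G a '' bumpSupp κ a) :=
  (isCompact_image_bumpSupp D i G ha hCM hκ hκ2).isClosed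

/-- **The push-forward `Ψᵢ` is smooth on `M'`.**  At a chart point `Θᵢ x` it agrees, along the local
smooth embedding with open range `Θᵢ|U` of file II, with the smooth `gᵢ`
(`contMDiffAt_of_comp_isImmersionAt_of_nhds`); off the closed `Θᵢ (bumpSupp)` it vanishes identically.
[cite: Kosinski1993, VI §1, proof of (1.1)] -/
theorem contMDiff_bumpPush (ha : 0 < a) (hCM : CollarAdapted D i G a) (hκ : 0 < κ) (hκ2 : κ ≤ 1 / 2) :
    ContMDiff 𝓘(ℝ, EuclideanSpace ℝ (Fin 4)) 𝓘(ℝ, ℝ) ∞ (bumpPush D i G a κ δ) := by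
  intro p
  by_cases hp : p ∈ gluedHandleChart D i G a '' bumpSupp κ a
  · obtain ⟨x₀, hx₀, rfl⟩ := hp
    have hx₀V : x₀ ∈ chartDom a := bumpSupp_subset_chartDom hκ hκ2 ha hx₀
    obtain ⟨U, hxU, hUV, hemb, hopen⟩ := exists_isSmoothEmbedding_gluedHandleChart D i G ha hCM hx₀V
    set jU : U → G.d₂.Glued := fun y => gluedHandleChart D i G a y with hjU
    have hk : IsOpenEmbedding jU := ⟨hemb.isEmbedding, hopen⟩
    have hg : ContMDiffAt 𝓘(ℝ, EuclideanSpace ℝ (Fin 4)) 𝓘(ℝ, ℝ) ∞ (fun y : U => bumpFn D i G a κ δ y.1) ⟨x₀, hxU⟩ :=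
      ((contMDiffOn_bumpFn D i G ha hCM (κ := κ) (δ := δ)).comp_contMDiff contMDiff_subtype_val
        fun y => hUV y.2) _
    have key := contMDiffAt_of_comp_isImmersionAt_of_nhds (f := bumpPush D i G a κ δ) (j := jU)
      (a := (⟨x₀, hxU⟩ : U)) (hemb.isImmersion.isImmersionAt _)
      (fun V hV => hk.isOpenMap.image_mem_nhds hV) hg
      (fun y => bumpPush_apply_chart D i G ha hCM (hUV y.2))
    exact key
  · have hev : bumpPush D i G a κ δ =ᶠ[𝓝 p] fun _ => (0 : ℝ) := by
      filter_upwards [(isClosed_image_bumpSupp D i G ha hCM hκ hκ2).isOpen_compl.mem_nhds hp] with q hq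
      exact bumpPush_eq_zero_of_not_mem D i G ha hCM hκ hq
    exact contMDiffAt_const.congr_of_eventuallyEq hev

/-- **Registered helper `helper_bumpPush_smooth` (sub-goal of `stub_steinRealisation`, T3b (iii), wave 4,
lead c5): the push-forward by zero of the cocore bump function along the glued handle chart is a smooth
function on Milnor's gluing, equal to the bump function on chart points and vanishing off the image of
the support box.** [cite: Kosinski1993, VI §1, proof of (1.1)] -/
theorem helper_bumpPush_smooth : ∀ {B : Type} [TopologicalSpace B] [T2Space B] [ChartedSpace (EuclideanHalfSpace 4) B] {ι : Type} [Finite ι] {h : ι → Literature.Topology.FourManifolds.HandleAttachingMap 3 2 B} {X : Type} [TopologicalSpace X] [ChartedSpace (EuclideanHalfSpace 4) X] [IsManifold (𝓡∂ 4) ∞ X] (D : Literature.Topology.FourManifolds.HandleAttachingMap.MultiAttachmentData h (𝓡∂ 4) X) (i : ι) {bX : Literature.Topology.FourManifolds.BoundaryData (𝓡∂ 4) X (𝓡 3)} {W : Type} [TopologicalSpace W] [ChartedSpace (EuclideanHalfSpace 4) W] [IsManifold (𝓡∂ 4) ∞ W] {bW : Literature.Topology.FourManifolds.BoundaryData (𝓡∂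 4) W (𝓡 3)} [Nonempty bX.carrier] (G : Literature.Topology.FourManifolds.BoundaryGlueData bX bW) {a κ δ : ℝ} [CompactSpace X] [T2Space X] [T2Space W] [CompactSpace W], 0 < a → Summit.SmoothPoincare4.SmoothPoincare4.Theorems.AcyclicBisectionExists.ModpBraidOrbits.CollarAdapted D i G a → 0 < κ → κ ≤ 1 / 2 → ContMDiff 𝓘(ℝ, EuclideanSpace ℝ (Fin 4)) 𝓘(ℝ, ℝ) ∞ (Summit.SmoothPoincare4.SmoothPoincare4.Theorems.AcyclicBisectionExists.ModpBraidOrbits.bumpPush D i G a κ δ) ∧ (∀ x ∈ Summit.SmoothPoincare4.SmoothPoincare4.Theorems.AcyclicBisectionExists.ModpBraidOrbits.chartDom a, Summit.SmoothPoincare4.SmoothPoincare4.Theorems.AcyclicBisectionExists.ModpBraidOrbits.bumpPush D i G a κ δ (Summit.SmoothPoincare4.SmoothPoincare4.Theorems.AcyclicBisectionExists.ModpBraidOrbits.gluedHandleChart D i G a x) = Summit.SmoothPoincare4.SmoothPoincare4.Theorems.AcyclicBisectionExists.ModpBraidOrbits.bumpFn D i G a κ δ x) ∧ (∀ p, p ∉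 Summit.SmoothPoincare4.SmoothPoincare4.Theorems.AcyclicBisectionExists.ModpBraidOrbits.gluedHandleChart D i G a '' Summit.SmoothPoincare4.SmoothPoincare4.Theorems.AcyclicBisectionExists.ModpBraidOrbits.bumpSupp κ a → Summit.SmoothPoincare4.SmoothPoincare4.Theorems.AcyclicBisectionExists.ModpBraidOrbits.bumpPush D i G a κ δ p = 0) := by
  intro B _ _ _ ι _ h X _ _ _ D i bX W _ _ _ bW _ G a κ δ _ _ _ _ ha hCM hκ hκ2
  exact ⟨contMDiff_bumpPush D i G ha hCM hκ hκ2, fun x hx => bumpPush_apply_chart D i G ha hCM hx,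
    fun p hp => bumpPush_eq_zero_of_not_mem D i G ha hCM hκ hp⟩

end Push

/-! ### §3 One-variable facts along rays (for the regularity computation of file IV) -/

section Ray

/-- `‖t • x‖² = t²` for a unit vector `x`. [folklore] -/
theorem norm_smul_unit_sq {x : EuclideanSpace ℝ (Fin 4)} (hn : ‖x‖ = 1) (t : ℝ) : ‖t • x‖ ^ 2 = t ^ 2 := by
  rw [norm_smul, hn, mul_one, Real.norm_eq_abs, sq_abs]

/-- `‖(t • x)_λ‖² = t² ‖x_λ‖²`. [folklore] -/
theorem norm_lamPart_smul_sq (x : EuclideanSpace ℝ (Fin 4)) (t : ℝ) :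
    ‖lamPart (t • x)‖ ^ 2 = t ^ 2 * ‖lamPart x‖ ^ 2 := by
  rw [lamPart_smul, norm_smul, Real.norm_eq_abs, mul_pow, sq_abs]

/-- `‖(t • x)_μ‖² = t² ‖x_μ‖²`. [folklore] -/
theorem norm_muPart_smul_sq (x : EuclideanSpace ℝ (Fin 4)) (t : ℝ) :
    ‖muPart (t • x)‖ ^ 2 = t ^ 2 * ‖muPart x‖ ^ 2 := by
  rw [muPart_smul, norm_smul, Real.norm_eq_abs, mul_pow, sq_abs]

/-- The seam height along the ray through a unit vector: `s(t • x) = (1 - t²)/(a - 1 + t²)`. [folklore] -/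
theorem seamHeight_smul_unit {x : EuclideanSpace ℝ (Fin 4)} (hn : ‖x‖ = 1) (a t : ℝ) :
    seamHeight a (t • x) = (1 - t ^ 2) / (a - 1 + t ^ 2) := by
  rw [seamHeight, norm_smul_unit_sq hn]

/-- **The derivative of the seam height along the ray at the sphere is `-2/a`.** [folklore] -/
theorem hasDerivAt_seamHeight_ray {a : ℝ} (ha : 0 < a) :
    HasDerivAt (fun t : ℝ => (1 - t ^ 2) / (a - 1 + t ^ 2)) (-(2 / a)) 1 := by
  have hnum : HasDerivAt (fun t : ℝ => 1 - t ^ 2) (-(2 : ℝ)) 1 := by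
    simpa using (hasDerivAt_pow 2 (1 : ℝ)).const_sub (1 : ℝ)
  have hden : HasDerivAt (fun t : ℝ => a - 1 + t ^ 2) (2 : ℝ) 1 := by
    simpa using (hasDerivAt_pow 2 (1 : ℝ)).const_add (a - 1)
  have h := hnum.fun_div hden (by norm_num; exact ha.ne')
  refine h.congr_deriv ?_
  have h1 : a - 1 + (1 : ℝ) ^ 2 = a := by ring
  rw [h1, div_eq_iff (by positivity)]
  field_simp
  ring

/-- Points of an open set stay in it along the ray, near `t = 1`. [folklore] -/
theorem eventually_smul_mem {U : Set (EuclideanSpace ℝ (Fin 4))} (hU : IsOpen U) {x : EuclideanSpace ℝ (Fin 4)}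
    (hx : x ∈ U) : ∀ᶠ t : ℝ in 𝓝 1, t • x ∈ U := by
  have hc : ContinuousAt (fun t : ℝ => t • x) 1 := (continuous_id.smul continuous_const).continuousAt
  refine hc.preimage_mem_nhds ?_
  rw [one_smul]
  exact hU.mem_nhds hx

end Ray


end Summit.SmoothPoincare4.SmoothPoincare4.Theorems.AcyclicBisectionExists.ModpBraidOrbits

end
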